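import Summits.CriticalPhenomena.SAWScalingLimit.Theses.SAWDefectDecoherence
import Summits.CriticalPhenomena.SAWScalingLimit.Theorems.SAWDefectDecoherenceBoundaryClosureREquivalence
import Summits.CriticalPhenomena.SAWScalingLimit.Theorems.SAWDefectDecoherencePolygonParitySqueezeDefs
import Summits.CriticalPhenomena.SAWScalingLimit.Theorems.SAWDefectDecoherenceBoundaryClosureRArrivalMonotone
import Summits.CriticalPhenomena.SAWScalingLimit.Theorems.SAWDefectDecoherenceBoundaryClosureRSqueeze
import Summits.CriticalPhenomena.SAWScalingLimit.Theorems.SAWDefectDecoherenceBoundaryClosureRGateTraceOfGateData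
import Summits.CriticalPhenomena.SAWScalingLimit.Theorems.SAWDefectDecoherenceBoundaryClosureRGateStability
import Summits.CriticalPhenomena.SAWScalingLimit.Theorems.SAWDefectDecoherenceBoundaryClosureRGateDbarLimit
import Summits.CriticalPhenomena.SAWScalingLimit.Theorems.SAWDefectDecoherenceBoundaryClosureRInnerZigzagSep
import Summits.CriticalPhenomena.SAWScalingLimit.Theorems.SAWDefectDecoherenceBoundaryClosureRZigzagDiscretisation
import Summits.CriticalPhenomena.SAWScalingLimit.Theorems.SAWDefectDecoherenceBoundaryClosureRPolygonIdentification
import HarnessLib.Audit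

/-!
# Crux `BoundaryClosureR` (stmt-CriticalPhenomena-14004) — line `polygon-parity-squeeze`
# (strategist, 2026-08-17): identify on EXACT-SIDED LATTICE POLYGONS by positivity-parity, then
# SQUEEZE the positive gate masses of every admissible family between inner polygons

STATE OF THE CRUX (certificate p122667): `BoundaryClosureR ↔ (DD → MR → [I] LocalL1Root ∧ [II]
GateTraceH)`.  This line is an ENGINE FOR [II] (the identification half); [I] rides as the model
input `GateL1Root` (the `L¹` law up to the flat gate, `⊇ LocalL1Root`).  It fuses the one UNTRIAGED
idea of the pool (`Ideas/quantised-corners-zero-budget.md`, filed 03:56Z 2026-08-16 after triage r1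
closed, never planned) with the squeeze of `Ideas/polygon-squeeze-flux-trace.md` (triage pass ×3,
merged into runge and then registered only as the raw input `FlatGateProfile` for general carriers).

MECHANISM.
(A) TAME CARRIERS.  An exact polygon family (`ExactPolygonFamily`): a Dobrushin domain whose boundary
is, near every point, a straight line in one of the three zigzag directions of `ℍ` (corners: the
intersection or union of two such half-planes — interior angles 60°, 120°, 240°, 300°), discretised
near every boundary point by an EXACT zigzag half-lattice `{v | n ≤ zigzagForm k v}` (the six forms
`±row`, `±col`, `±(col + row + type)`; each has dangling edges of ONE class, checked on the embedded
lattice), so that EVERY boundary mid-edge carries a rigid phase and a positive mass — no free collar,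
no Kennedy–Lawler mixing, no corridor.  On such carriers the identification is LOCAL SIGN ARITHMETIC
(quantised corners): the side-wise Green identity (weighted star regrouping, landed as
`Engine.pickEngine_starRegrouping`, with DD + the layer budget for the twisted term and the `L¹` law
up to the side for the Taylor term) gives `∫ g ∂̄φ = e^{iβ_j} ∫_side φ dλ_j`, `λ_j ≥ 0`; the phase
jumps at corners and at the root equal EXACTLY the monodromy of `(Φ_P')^{5/8}` resp. `(z−a)^{-5/4}`,
so `G := g/(Φ_P')^{5/8}` has, after one global phase, POSITIVE MEASURE boundary values on every side;
tempered growth (mean value + `L¹`) makes its boundary distribution exist across corners, finiteness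
of the arrival measure leaves at most a simple pole at each corner (order ≥ 2 is not a measure),
positivity on both half-axes kills the simple pole (a real `b/w` changes sign), the root weight
`(z−a)^{5/4}` and RootTightness do the same at `a`; Schwarz reflection with real measure boundary
values (edge of the wedge) continues `G∘ψ_P` to an entire bounded function: CONSTANT (Liouville; the
card's zero budget).  RatioMixing at `b` fixes the constant ⇒ the GATE PROFILE LAW on polygons
(`PolygonGateProfile`): `δ Σ_gate χ(δe) Z_δ(e)/Z_δ(b_δ) → ∫ χ (Φ_P'/Φ_P'(b))^{5/8} dx`.
(B) SQUEEZE (positive masses only).  For ANY admissible family `(D, Λ_δ)` — free rough collar and all —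
and an inner exact polygon `P ⊆ D` sharing the two pinned pieces and containing `D` minus an
`η`-collar, domain monotonicity of the `σ = 0` masses (`Z_{Λ^P} ≤ Z_Λ`, walk sets are nested) and
`GateCollarAvoidance` (`Z_{Λ ∖ collar}(a→z) ≥ (1−ε) Z_Λ(a→z)` for targets `z` in the gate half-ball)
pinch the gate profile AND the gate layer budget of `Λ_δ` between those of `Λ^P_δ` up to `1 ± 2ε`;
Carathéodory convergence `Φ_P → Φ_D` with derivatives on the shared gate (reflection) sends `ε → 0`:
`GateData` (profile + budget) for every admissible family, the collar never analysed.
(C) GATE TRACE.  Given `GateData`, `GateL1Root`, DD, MR: the gate identity on the half-ball at `b`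
passes to the limit (singular boundary part killed by test functions `Im(z−y)·χ`), and flat-arc
uniqueness + the identity theorem identify EVERY holomorphic weak limit: `GateTraceH` with an explicit
lattice constant `c`.

REGISTERED STUBS (lead c6, reshape r6, 2026-08-17).  OPEN (the only `sorry`s): the three MODEL INPUTS
`stub_gateL1Root` ([I]-type, ⊇ LocalL1Root, necessary-type), `stub_polygonPackage` (polygon-level: `L¹` up to
sides + root tightness; boundary layer budgets; ratio mixing at `b` — tame carriers only), `stub_gateCollarAvoidance`
(positive, qualitative) — audited open / not vacuous / no cheap kill; THEY ARE THE ONLY `sorry`s LEFT (r6).  CLOSED: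
`stub_polygonIdentification` ((A), p167819 over C1 p156917, C2 p160207, D p162668, E p167021, F p156768 …), the
inner-polygon construction (IP) — `stub_innerZigzagPolygon` p153105, `stub_innerZigzagPolygonSep` p154287,
`stub_innerPolygonsOfZigzag` p161626 —, `stub_arrivalMonotone` (p137937),
`stub_gateStability` ((GS) Carathéodory kernel convergence of the frames of inner domains + reflection at both pins,
p145306), `stub_gateDbarLimit` ((GDL) the gate `∂̄`-limit from DD + gate budget + gate profile, p145867), hence
`stub_innerPolygons` (:= lattice ∘ continuum), `stub_squeeze` (:= `squeeze_of_innerPolygons` IP GS, p141029) and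
`stub_gateTrace` (:= `gateTrace_of_gateDbarLimit` GDL, p141188; universal constant `c = 2√3`).  Composition
`BoundaryClosureR_of` through the landed `Equivalence.target_of_inputs`.  Census: `Cruxes/BoundaryClosureR/STRATEGY-CENSUS.md`.

DISPROOF USED: §1 both pins are USED, not merely kept — the root monodromy datum exists only on the
exact root row (`target_false_without_rootPin`), the gate profile/ratio mixing only on the exact gate
row (`target_false_without_normaliserPin`); §6 (F7, snail carrier): no half-plane bound on a developing
map is posited — curled carriers of `D` are handled by the squeeze, and polygons may be non-convex
(reflex corners are where parity works).  No stub is an instance of a landed Negative lemma.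
-/

noncomputable section

open scoped BigOperators ComplexConjugate Topology Classical ContDiff
open Filter Set MeasureTheory
open Literature.Probability.LatticeModels Literature.Probability.RandomPlanarGeometry
open Literature.Probability.RandomPlanarGeometry.SAW
open Summit.CriticalPhenomena.SAWScalingLimit.Theses.SAWDefectDecoherence

open Summit.CriticalPhenomena.SAWScalingLimit.Theorems.PolygonParitySqueeze

namespace Summit.CriticalPhenomena.SAWScalingLimit.Cruxes.BoundaryClosureR.PolygonParitySqueeze

/-! ## A. Vocabulary: `Theorems/SAWDefectDecoherencePolygonParitySqueezeDefs.lean` (p137823, landed) —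
`NF`, `IsTest`, `AdmissibleFamily`, `PinnedFlatRoot`, `IsWeakLimit`, `L1BoundOn`, `HasGateTrace`, `gateSeg`,
`ConformalFrame`, `zigzagForm`, `innerNormal`, `halfPlane`, `IsFlatSideAt`, `IsCornerAt`, `ExactPolygonFamily`,
`RootTightAt`, `starMass`, `IsMetricDepth`, `BoundaryLayerBudgetAt`, `GateLayerBudgetAt`, `RatioMixingAt`,
`GateProfileAt`, `collarDomain`, `CollarAvoidanceAt` (opened below). -/

/-! ## B. The closed statements of the line (universal closures of the predicates; skeleton-only) -/

/-- **[I] LOCAL `L¹` LAW AT THE ROOT** (certificate input 1/2, NECESSARY for the target, p122434):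
`L1BoundOn` for every compact of the carrier, root pinned at `pt 0`. OPEN. -/
def LocalL1Root : Prop :=
  ∀ (D : DobrushinDomain) (ρ : ℝ) (Λ : ℝ → Finset HexVertex) (m : ℝ → ℤ) (b : ℝ → Sym2 HexVertex),
    AdmissibleFamily D ρ Λ m b →
  ∀ (a : ℝ → Sym2 HexVertex) (r₀ : ℝ) (m₀ : ℝ → ℤ), PinnedFlatRoot D Λ b (D.pt 0) a r₀ m₀ →
  ∀ K : Set ℂ, IsCompact K → K ⊆ D.carrier → L1BoundOn Λ a b K

/-- **[II] GATE TRACE OF HOLOMORPHIC WEAK LIMITS** (certificate input 2/2, NECESSARY for the target,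
p121923): one universal `c ≠ 0` with `HasGateTrace c` for every admissible pinned datum. OPEN. -/
def GateTraceH : Prop :=
  ∃ c : ℂ, c ≠ 0 ∧
    ∀ (D : DobrushinDomain) (ρ : ℝ) (Λ : ℝ → Finset HexVertex) (m : ℝ → ℤ) (b : ℝ → Sym2 HexVertex),
      AdmissibleFamily D ρ Λ m b →
    ∀ (a : ℝ → Sym2 HexVertex) (r₀ : ℝ) (m₀ : ℝ → ℤ), PinnedFlatRoot D Λ b (D.pt 0) a r₀ m₀ →
      HasGateTrace c D ρ Λ a b

/-- **[I] up to the gate** (MODEL INPUT `stub_gateL1Root`; ⊇ `LocalL1Root`): `L1BoundOn` for every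
compact `K ⊆ Ω ∪ gate` avoiding the root. OPEN (no engine in this line; see line meso-cauchy-poincare). -/
def GateL1Root : Prop :=
  ∀ (D : DobrushinDomain) (ρ : ℝ) (Λ : ℝ → Finset HexVertex) (m : ℝ → ℤ) (b : ℝ → Sym2 HexVertex),
    AdmissibleFamily D ρ Λ m b →
  ∀ (a : ℝ → Sym2 HexVertex) (r₀ : ℝ) (m₀ : ℝ → ℤ), PinnedFlatRoot D Λ b (D.pt 0) a r₀ m₀ →
  ∀ K : Set ℂ, IsCompact K → K ⊆ D.carrier ∪ gateSeg D ρ → D.pt 0 ∉ K → L1BoundOn Λ a b K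

/-- **Polygon input (i)**: on exact polygon families, `L1BoundOn` for every compact of the CLOSED
carrier avoiding the root, plus root tightness at `pt 0`. [I]-type, TAME carriers. OPEN. -/
def PolygonL1 : Prop :=
  ∀ (D : DobrushinDomain) (ρ : ℝ) (Λ : ℝ → Finset HexVertex) (m : ℝ → ℤ) (b : ℝ → Sym2 HexVertex),
    AdmissibleFamily D ρ Λ m b → ExactPolygonFamily D Λ →
  ∀ (a : ℝ → Sym2 HexVertex) (r₀ : ℝ) (m₀ : ℝ → ℤ), PinnedFlatRoot D Λ b (D.pt 0) a r₀ m₀ →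
  (∀ K : Set ℂ, IsCompact K → K ⊆ closure D.carrier → D.pt 0 ∉ K → L1BoundOn Λ a b K) ∧
    RootTightAt Λ a b (D.pt 0)

/-- **Polygon input (ii)**: boundary layer budgets at every boundary point other than the root, and the
gate layer budget on `B(pt 1, ρ/2)` when the pinned balls are disjoint. POSITIVE masses. OPEN. -/
def PolygonLayerBudget : Prop :=
  ∀ (D : DobrushinDomain) (ρ : ℝ) (Λ : ℝ → Finset HexVertex) (m : ℝ → ℤ) (b : ℝ → Sym2 HexVertex),
    AdmissibleFamily D ρ Λ m b → ExactPolygonFamily D Λ →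
  ∀ (a : ℝ → Sym2 HexVertex) (r₀ : ℝ) (m₀ : ℝ → ℤ), PinnedFlatRoot D Λ b (D.pt 0) a r₀ m₀ →
  (∀ z ∈ frontier D.carrier, z ≠ D.pt 0 → BoundaryLayerBudgetAt Λ a b z) ∧
    (2 * ρ < dist (D.pt 0) (D.pt 1) → GateLayerBudgetAt D (ρ / 2) Λ m a b)

/-- **Polygon input (iii)**: averaged ratio mixing at `b`. POSITIVE masses, qualitative. OPEN. -/
def PolygonRatioMixing : Prop :=
  ∀ (D : DobrushinDomain) (ρ : ℝ) (Λ : ℝ → Finset HexVertex) (m : ℝ → ℤ) (b : ℝ → Sym2 HexVertex),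
    AdmissibleFamily D ρ Λ m b → ExactPolygonFamily D Λ →
  ∀ (a : ℝ → Sym2 HexVertex) (r₀ : ℝ) (m₀ : ℝ → ℤ), PinnedFlatRoot D Λ b (D.pt 0) a r₀ m₀ →
    RatioMixingAt Λ a b

/-- **THE POLYGON PACKAGE** (MODEL INPUT `stub_polygonPackage`). -/
def PolygonPackage : Prop := PolygonL1 ∧ PolygonLayerBudget ∧ PolygonRatioMixing

/-- **GATE PROFILE LAW ON EXACT POLYGONS** (output of `stub_polygonIdentification`): the gate arrival
profile law on `B(pt 1, ρ/2)` for exact polygon families with disjoint pinned balls. -/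
def PolygonGateProfile : Prop :=
  ∀ (D : DobrushinDomain) (ρ : ℝ) (Λ : ℝ → Finset HexVertex) (m : ℝ → ℤ) (b : ℝ → Sym2 HexVertex),
    AdmissibleFamily D ρ Λ m b → ExactPolygonFamily D Λ →
  ∀ (a : ℝ → Sym2 HexVertex) (r₀ : ℝ) (m₀ : ℝ → ℤ), PinnedFlatRoot D Λ b (D.pt 0) a r₀ m₀ →
    2 * ρ < dist (D.pt 0) (D.pt 1) → GateProfileAt D ρ (ρ / 2) Λ a b

/-- **GATE COLLAR AVOIDANCE** (MODEL INPUT `stub_gateCollarAvoidance`; positive masses, qualitative). -/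
def GateCollarAvoidance : Prop :=
  ∀ (D : DobrushinDomain) (ρ : ℝ) (Λ : ℝ → Finset HexVertex) (m : ℝ → ℤ) (b : ℝ → Sym2 HexVertex),
    AdmissibleFamily D ρ Λ m b →
  ∀ (a : ℝ → Sym2 HexVertex) (r₀ : ℝ) (m₀ : ℝ → ℤ), PinnedFlatRoot D Λ b (D.pt 0) a r₀ m₀ →
    CollarAvoidanceAt D ρ Λ a r₀

/-- **GATE DATA for general admissible families** (output of the squeeze, input of the gate trace):
profile law and gate layer budget on `B(pt 1, ρ/4)`, disjoint pinned balls. -/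
def GateData : Prop :=
  ∀ (D : DobrushinDomain) (ρ : ℝ) (Λ : ℝ → Finset HexVertex) (m : ℝ → ℤ) (b : ℝ → Sym2 HexVertex),
    AdmissibleFamily D ρ Λ m b →
  ∀ (a : ℝ → Sym2 HexVertex) (r₀ : ℝ) (m₀ : ℝ → ℤ), PinnedFlatRoot D Λ b (D.pt 0) a r₀ m₀ →
    2 * ρ < dist (D.pt 0) (D.pt 1) → GateProfileAt D ρ (ρ / 4) Λ a b ∧ GateLayerBudgetAt D (ρ / 4) Λ m a b

/-- **DOMAIN MONOTONICITY OF THE `σ = 0` MASSES** (stub `stub_arrivalMonotone`, LANDED as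
`Theorems/…ArrivalMonotone.lean`, p137937): `Λ ⊆ Λ' ⇒ ‖F_{Λ,a,x,0}(z)‖ ≤ ‖F_{Λ',a,x,0}(z)‖` for `x ≥ 0`. -/
def ArrivalMonotone : Prop :=
  ∀ (Λ Λ' : Finset HexVertex), Λ ⊆ Λ' → ∀ (a z : Sym2 HexVertex) (x : ℝ), 0 ≤ x →
    ‖hexParafermionicObservable Λ a x 0 z‖ ≤ ‖hexParafermionicObservable Λ' a x 0 z‖

/-- **(IP) INNER EXACT POLYGONS** (stub `stub_innerPolygons`, = `stub_innerPolygonsOfZigzag ∘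
stub_innerZigzagPolygon`): for every admissible pinned datum with disjoint pinned balls and every collar width
`η > 0`, an inner Dobrushin domain `P ⊆ Ω` with the same marked points containing the `η`-interior, and an exact
polygon family `Λ^P` on it (admissible at radius `ρ/2`, pinned at the root at radius `min r₀ ρ/4`), sandwiched
`collarDomain D (3ρ/4) (min r₀ ρ/2) η δ (Λ δ) ⊆ Λ^P δ ⊆ Λ δ` eventually. [folklore] -/
def InnerPolygons : Prop :=
  (∀ (D : DobrushinDomain) (ρ : ℝ) (Λ : ℝ → Finset HexVertex) (m : ℝ → ℤ) (b : ℝ → Sym2 HexVertex), AdmissibleFamily D ρ Λ m b → ∀ (a : ℝ → Sym2 HexVertex) (r₀ : ℝ) (m₀ : ℝ → ℤ), PinnedFlatRoot D Λ b (D.pt 0) a r₀ m₀ → 2 * ρ < dist (D.pt 0) (D.pt 1) → ∀ η : ℝ, 0 < η → ∃ (P : DobrushinDomain) (ΛP : ℝ → Finset HexVertex), P.pt 0 = D.pt 0 ∧ P.pt 1 = D.pt 1 ∧ P.carrier ⊆ D.carrier ∧ {z : ℂ | z ∈ D.carrier ∧ η ≤ Metric.infDist z D.carrierᶜ} ⊆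 P.carrier ∧ AdmissibleFamily P (ρ / 2) ΛP m b ∧ ExactPolygonFamily P ΛP ∧ PinnedFlatRoot P ΛP b (P.pt 0) a (min r₀ ρ / 4) m₀ ∧ ∀ᶠ δ : ℝ in 𝓝[>] 0, collarDomain D (3 * ρ / 4) (min r₀ ρ / 2) η δ (Λ δ) ⊆ ΛP δ ∧ ΛP δ ⊆ Λ δ)

/-- **(IP-continuum) INNER ZIGZAG POLYGON** (stub `stub_innerZigzagPolygon`, worker plan
`InnerPolygons_PLAN.lean` A1–A4): inside a Jordan domain flat at two boundary points, for every `η > 0`, a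
Dobrushin domain with the same marked points, boundary a zigzag polygon (sides in the directions 0°, 60°, 120°;
corners 60°/120°/240°/300°), containing the `η`-interior, EXACT half-balls at both pins, boundary inside `Ω` away
from the pins. [folklore] -/
def InnerZigzagPolygon : Prop :=
  ∀ (D : DobrushinDomain) (ρ r₁ η : ℝ), 0 < ρ → 0 < r₁ → 0 < η → D.carrier ∩ Metric.ball (D.pt 1) ρ = {z : ℂ | (D.pt 1).im < z.im} ∩ Metric.ball (D.pt 1) ρ → D.carrier ∩ Metric.ball (D.pt 0) r₁ = {z : ℂ | (D.pt 0).im < z.im} ∩ Metric.ball (D.pt 0) r₁ → ρ + r₁ ≤ dist (D.pt 0) (D.pt 1) → ∃ (P : DobrushinDomain) (corners : Finset ℂ) (r : ℝ), P.pt 0 = D.pt 0 ∧ P.pt 1 = D.pt 1 ∧ P.carrier ⊆ D.carrier ∧ {z : ℂ | z ∈ D.carrier ∧ η ≤ Metric.infDist z D.carrierᶜ} ⊆ P.carrier ∧ P.carrier ∩ Metric.ball (D.pt 1) (7 * ρ / 8) = {z : ℂ | (D.pt 1).im < z.im} ∩ Metric.ball (D.pt 1) (7 * ρ / 8) ∧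 P.carrier ∩ Metric.ball (D.pt 0) (7 * r₁ / 8) = {z : ℂ | (D.pt 0).im < z.im} ∩ Metric.ball (D.pt 0) (7 * r₁ / 8) ∧ frontier P.carrier \ (Metric.ball (D.pt 1) (15 * ρ / 16) ∪ Metric.ball (D.pt 0) (15 * r₁ / 16)) ⊆ D.carrier ∧ 0 < r ∧ r ≤ ρ / 16 ∧ r ≤ r₁ / 16 ∧ (↑corners : Set ℂ) ⊆ frontier P.carrier ∧ (∀ i : Fin 2, ∀ c ∈ corners, r ≤ dist (P.pt i) c) ∧ (∀ z ∈ frontier P.carrier, (∀ c ∈ corners, r ≤ dist z c) → ∃ k : Fin 6, P.carrier ∩ Metric.ball z (r / 2) = halfPlane k z ∩ Metric.ball z (r / 2)) ∧ (∀ z ∈ corners, ∃ k k' : Fin 6, P.carrier ∩ Metric.ball z (2 * r) = halfPlane k z ∩ halfPlane k' z ∩ Metric.ball z (2 * r) ∨ P.carrier ∩ Metric.ball z (2 * r) = (halfPlane k z ∪ halfPlane k' z) ∩ Metric.ball z (2 * r))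

/-- **(IP-continuum, with corner separation) INNER ZIGZAG POLYGON** (stub `stub_innerZigzagPolygonSep`, LANDED
p154287 = `stub_innerZigzagPolygon` p153105 + pairwise corner separation `4r ≤ dist c c'`, free in the construction). [folklore] -/
def InnerZigzagPolygonSep : Prop :=
  ∀ (D : DobrushinDomain) (ρ r₁ η : ℝ), 0 < ρ → 0 < r₁ → 0 < η → D.carrier ∩ Metric.ball (D.pt 1) ρ = {z : ℂ | (D.pt 1).im < z.im} ∩ Metric.ball (D.pt 1) ρ → D.carrier ∩ Metric.ball (D.pt 0) r₁ = {z : ℂ | (D.pt 0).im < z.im} ∩ Metric.ball (D.pt 0) r₁ → ρ + r₁ ≤ dist (D.pt 0) (D.pt 1) → ∃ (P : DobrushinDomain) (corners : Finset ℂ) (r : ℝ), P.pt 0 = D.pt 0 ∧ P.pt 1 = D.pt 1 ∧ P.carrier ⊆ D.carrier ∧ {z : ℂ | z ∈ D.carrier ∧ η ≤ Metric.infDist z D.carrierᶜ} ⊆ P.carrier ∧ P.carrier ∩ Metric.ball (D.pt 1) (7 * ρ / 8) = {z : ℂ | (D.pt 1).im < z.im} ∩ Metric.ball (D.pt 1)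 (7 * ρ / 8) ∧ P.carrier ∩ Metric.ball (D.pt 0) (7 * r₁ / 8) = {z : ℂ | (D.pt 0).im < z.im} ∩ Metric.ball (D.pt 0) (7 * r₁ / 8) ∧ frontier P.carrier \ (Metric.ball (D.pt 1) (15 * ρ / 16) ∪ Metric.ball (D.pt 0) (15 * r₁ / 16)) ⊆ D.carrier ∧ 0 < r ∧ r ≤ ρ / 16 ∧ r ≤ r₁ / 16 ∧ (↑corners : Set ℂ) ⊆ frontier P.carrier ∧ (∀ i : Fin 2, ∀ c ∈ corners, r ≤ dist (P.pt i) c) ∧ (∀ c ∈ corners, ∀ c' ∈ corners, c ≠ c' → 4 * r ≤ dist c c') ∧ (∀ z ∈ frontier P.carrier, (∀ c ∈ corners, r ≤ dist z c) → ∃ k : Fin 6, P.carrier ∩ Metric.ball z (r / 2) = halfPlane k z ∩ Metric.ball z (r / 2)) ∧ (∀ z ∈ corners, ∃ k k' : Fin 6, P.carrier ∩ Metric.ball z (2 * r) = halfPlane k z ∩ halfPlane k' z ∩ Metric.ball z (2 * r) ∨ P.carrier ∩ Metric.ball z (2 * r) = (halfPlane k z ∪ halfPlane k' z) ∩ Metric.ball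 z (2 * r))

/-- **(GS) GATE STABILITY** (stub `stub_gateStability`, LANDED p145306): for inner Dobrushin domains
`P_n ⊆ Ω` with the same marked points and the same flat pieces at both pins, exhausting the compacts of `Ω`, frames
of the `P_n` exist whose gate densities `exp((5/8)(L̄_n − L_{b,n}))` converge to that of `Ω` uniformly on
`gateSeg D (ρ/4)` (normal families + Schwarz reflection at both exact pins; no uniform local connectedness needed).
[cite: PommerenkeBBCM1992, Thm. 1.8] -/
def GateStability : Prop :=
  (∀ (D : DobrushinDomain) (ρ r₀ r' : ℝ), 0 < ρ → 0 < r' → r' ≤ r₀ → D.carrier ∩ Metric.ball (D.pt 1) ρ = {z : ℂ | (D.pt 1).im < z.im} ∩ Metric.ball (D.pt 1) ρ → D.carrier ∩ Metric.ball (D.pt 0) r₀ = {z : ℂ | (D.pt 0).im < z.im} ∩ Metric.ball (D.pt 0) r₀ → 2 * ρ < dist (D.pt 0) (D.pt 1) → ∀ (Φ : ConformalEquiv D.carrier UpperHalfPlane.upperHalfPlaneSet) (L : ℂ → ℂ) (Lb : ℂ), ConformalFrame D Φ L Lb → ∀ (Lbar : ℂ → ℂ), ContinuousOn Lbar (D.carrier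 ∪ gateSeg D ρ) → EqOn Lbar L D.carrier → ∀ (P : ℕ → DobrushinDomain), (∀ n, (P n).pt 0 = D.pt 0 ∧ (P n).pt 1 = D.pt 1 ∧ (P n).carrier ⊆ D.carrier ∧ (P n).carrier ∩ Metric.ball (D.pt 1) (ρ / 2) = {z : ℂ | (D.pt 1).im < z.im} ∩ Metric.ball (D.pt 1) (ρ / 2) ∧ (P n).carrier ∩ Metric.ball (D.pt 0) r' = {z : ℂ | (D.pt 0).im < z.im} ∩ Metric.ball (D.pt 0) r') → (∀ K : Set ℂ, IsCompact K → K ⊆ D.carrier → ∀ᶠ n : ℕ in atTop, K ⊆ (P n).carrier) → ∃ (ΦP : (n : ℕ) → ConformalEquiv (P n).carrier UpperHalfPlane.upperHalfPlaneSet) (LP : ℕ → ℂ → ℂ) (LbP : ℕ → ℂ) (LbarP : ℕ → ℂ → ℂ), (∀ n, ConformalFrame (P n) (ΦP n) (LP n) (LbP n) ∧ ContinuousOn (LbarP n) ((P n).carrier ∪ gateSeg (P n) (ρ / 2)) ∧ EqOn (LbarP n) (LP n) (P n).carrier) ∧ TendstoUniformlyOn (fun n x => Complex.exp ((5 / 8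 : ℂ) * (LbarP n x - LbP n))) (fun x => Complex.exp ((5 / 8 : ℂ) * (Lbar x - Lb))) atTop (gateSeg D (ρ / 4)))

/-- **(GDL) GATE `∂̄`-LIMIT** (stub `stub_gateDbarLimit`, LANDED p145867): for an admissible pinned family
with disjoint pinned balls, `DefectDecoherence`, the gate profile law and the gate layer budget on `B(pt 1, ρ/4)`:
`N_δ(∂̄φ) → −i√3 ∫ φ(x + i·im pt 1) exp((5/8)(L̄ − L_b)) dx` for every smooth `φ` supported in `B(pt 1, ρ/4)`
(DCS Lemma 1 summed against `φ`; the twisted term is the DefectDecoherence star sum).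
[cite: DuminilCopinSmirnov2012, Lemma 1] -/
def GateDbarLimit : Prop :=
  (∀ (D : DobrushinDomain) (ρ : ℝ) (Λ : ℝ → Finset HexVertex) (m : ℝ → ℤ) (b : ℝ → Sym2 HexVertex), AdmissibleFamily D ρ Λ m b → ∀ (a : ℝ → Sym2 HexVertex) (r₀ : ℝ) (m₀ : ℝ → ℤ), PinnedFlatRoot D Λ b (D.pt 0) a r₀ m₀ → 2 * ρ < dist (D.pt 0) (D.pt 1) → DefectDecoherence → GateProfileAt D ρ (ρ / 4) Λ a b → GateLayerBudgetAt D (ρ / 4) Λ m a b → ∀ (Φ : ConformalEquiv D.carrier UpperHalfPlane.upperHalfPlaneSet) (L : ℂ → ℂ) (Lb : ℂ), ConformalFrame D Φ L Lb → ∀ (Lbar : ℂ → ℂ), ContinuousOn Lbar (D.carrier ∪ gateSeg D ρ) → Set.EqOn Lbar L D.carrier → ∀ (φ : ℂ → ℂ), ContDiff ℝ ∞ φ → HasCompactSupport φ → tsupport φ ⊆ Metric.ball (D.pt 1) (ρ / 4) → Filter.Tendsto (fun δ : ℝ => NF Λ a b δ (Literature.Analysis.Complex.dbarAlong 1 φ))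 (𝓝[>] 0) (𝓝 (-(Complex.I * (Real.sqrt 3 : ℂ)) * ∫ x in Set.Ioo ((D.pt 1).re - ρ / 4) ((D.pt 1).re + ρ / 4), φ ((x : ℂ) + ((D.pt 1).im : ℂ) * Complex.I) * Complex.exp ((5 / 8 : ℂ) * (Lbar ((x : ℂ) + ((D.pt 1).im : ℂ) * Complex.I) - Lb)))))

/-! ## C. Sorry-free glue inside the line -/

/-- The pinned root is not a point of the (open) carrier. [folklore] -/
theorem root_not_mem_carrier {D : DobrushinDomain} {Λ : ℝ → Finset HexVertex} {b : ℝ → Sym2 HexVertex}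
    {x : ℂ} {e : ℝ → Sym2 HexVertex} {r : ℝ} {mr : ℝ → ℤ}
    (hPR : PinnedFlatRoot D Λ b x e r mr) : x ∉ D.carrier := by
  intro hx
  have h1 : x ∈ D.carrier ∩ Metric.ball x r := ⟨hx, Metric.mem_ball_self hPR.1⟩
  rw [hPR.2.1] at h1
  have h2 : x.im < x.im := h1.1
  exact lt_irrefl _ h2

/-- `GateL1Root` restricted to compacts of the carrier is `LocalL1Root`. [folklore] -/
theorem localL1Root_of_gateL1Root (h : GateL1Root) : LocalL1Root :=
  fun D ρ Λ m b hAF a r₀ m₀ hPR K hK hKD =>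
    h D ρ Λ m b hAF a r₀ m₀ hPR K hK (hKD.trans Set.subset_union_left)
      (fun hx => root_not_mem_carrier hPR (hKD hx))

/-! ## D. The registered stubs (the only `sorry`s of the file).  Headers are written in the
parametrised predicates of the Defs file; each is definitionally the named statement of §B
(`stub_X_iff` below is `Iff.rfl`). -/

/-- STUB 1 (MODEL INPUT, [I]-type, ⊇ `LocalL1Root` — necessary-type; OPEN): `GateL1Root`. -/
theorem stub_gateL1Root : ∀ (D : DobrushinDomain) (ρ : ℝ) (Λ : ℝ → Finset HexVertex) (m : ℝ → ℤ) (b : ℝ → Sym2 HexVertex), AdmissibleFamily D ρ Λ m b → ∀ (a : ℝ → Sym2 HexVertex) (r₀ : ℝ) (m₀ : ℝ → ℤ), PinnedFlatRoot D Λ b (D.pt 0) a r₀ m₀ → ∀ K : Set ℂ, IsCompact K → K ⊆ D.carrier ∪ gateSeg D ρ → D.pt 0 ∉ K → L1BoundOn Λ a b K := by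
  sorry

/-- STUB 2 (MODEL INPUT, polygon-level, TAME carriers only; OPEN): `PolygonPackage` =
`PolygonL1 ∧ PolygonLayerBudget ∧ PolygonRatioMixing`. -/
theorem stub_polygonPackage : (∀ (D : DobrushinDomain) (ρ : ℝ) (Λ : ℝ → Finset HexVertex) (m : ℝ → ℤ) (b : ℝ → Sym2 HexVertex), AdmissibleFamily D ρ Λ m b → ExactPolygonFamily D Λ → ∀ (a : ℝ → Sym2 HexVertex) (r₀ : ℝ) (m₀ : ℝ → ℤ), PinnedFlatRoot D Λ b (D.pt 0) a r₀ m₀ → (∀ K : Set ℂ, IsCompact K → K ⊆ closure D.carrier → D.pt 0 ∉ K → L1BoundOn Λ a b K) ∧ RootTightAt Λ a b (D.pt 0)) ∧ (∀ (D : DobrushinDomain) (ρ : ℝ) (Λ : ℝ → Finset HexVertex) (m : ℝ → ℤ) (b : ℝ → Sym2 HexVertex), AdmissibleFamily D ρ Λ m b → ExactPolygonFamily D Λ → ∀ (a : ℝ → Sym2 HexVertex) (r₀ : ℝ) (m₀ : ℝ → ℤ), PinnedFlatRoot D Λ b (D.pt 0) a r₀ m₀ → (∀ z ∈ frontier D.carrier,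 z ≠ D.pt 0 → BoundaryLayerBudgetAt Λ a b z) ∧ (2 * ρ < dist (D.pt 0) (D.pt 1) → GateLayerBudgetAt D (ρ / 2) Λ m a b)) ∧ (∀ (D : DobrushinDomain) (ρ : ℝ) (Λ : ℝ → Finset HexVertex) (m : ℝ → ℤ) (b : ℝ → Sym2 HexVertex), AdmissibleFamily D ρ Λ m b → ExactPolygonFamily D Λ → ∀ (a : ℝ → Sym2 HexVertex) (r₀ : ℝ) (m₀ : ℝ → ℤ), PinnedFlatRoot D Λ b (D.pt 0) a r₀ m₀ → RatioMixingAt Λ a b) := by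
  sorry

/-- STUB 3 (CLOSED — LANDED p167819 `Theorems/…BoundaryClosureRPolygonIdentification.lean`; mechanism (A)):
**identification on exact polygons**, `PolygonPackage → DefectDecoherence → MassRatio → PolygonGateProfile`.  Assembly:
`polygonLimitData` (C1 p156917: subsequence, holomorphic bulk weak limit `g`, limit functional `η`, boundary measure `μ`),
`polygonLocalIdentity` (C2 p160207: boundary phase `κ`, local continuum identity `∫_P g ∂̄φ = −√3 n_k κ ∫ φ dμ`, no
singular boundary part), `boundaryPhaseBookkeeping` (D p162668: the invariant `κ·n_k·e^{i(3/8) Im L} ≡ i·e^{i(3/8) Im L_b}`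
along `∂P ∖ {a}`), `transportRigidity` (E p167021: transport to `ℍ` + `realLine_rigidity` p148752 — Schwarz reflection,
pole order, parity, weighted Liouville; `cornerStructure` p149386; `frameTransport_dbar` p148183),
`gateProfile_of_identification` (F p156768: Green on gate half-balls, ratio mixing fixes the constant, subsequence
principle), `exactPolygon_covers` p162294, `rootIntegrable_of_limitData` p161992; lattice inputs `polygonGreenPairing`
p150253, `sidePhase_flat` p141884, `sidePhase_corner` p153335, `sideMeasure_weakStarLimit` p141839; non-vacuity of the
hypothesis class `exactPolygonDatum_exists` p163527. [cite: DuminilCopinSmirnov2012, Conjecture 2 (boundary shadow on the gate)] -/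
theorem stub_polygonIdentification : ((∀ (D : DobrushinDomain) (ρ : ℝ) (Λ : ℝ → Finset HexVertex) (m : ℝ → ℤ) (b : ℝ → Sym2 HexVertex), AdmissibleFamily D ρ Λ m b → ExactPolygonFamily D Λ → ∀ (a : ℝ → Sym2 HexVertex) (r₀ : ℝ) (m₀ : ℝ → ℤ), PinnedFlatRoot D Λ b (D.pt 0) a r₀ m₀ → (∀ K : Set ℂ, IsCompact K → K ⊆ closure D.carrier → D.pt 0 ∉ K → L1BoundOn Λ a b K) ∧ RootTightAt Λ a b (D.pt 0)) ∧ (∀ (D : DobrushinDomain) (ρ : ℝ) (Λ : ℝ → Finset HexVertex) (m : ℝ → ℤ) (b : ℝ → Sym2 HexVertex), AdmissibleFamily D ρ Λ m b → ExactPolygonFamily D Λ → ∀ (a : ℝ → Sym2 HexVertex) (r₀ : ℝ) (m₀ : ℝ → ℤ), PinnedFlatRoot D Λ b (D.pt 0) a r₀ m₀ → (∀ z ∈ frontier D.carrier, z ≠ D.pt 0 → BoundaryLayerBudgetAt Λ a b z) ∧ (2 * ρ < dist (D.pt 0) (D.pt 1) → GateLayerBudgetAt D (ρ / 2) Λ m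 a b)) ∧ (∀ (D : DobrushinDomain) (ρ : ℝ) (Λ : ℝ → Finset HexVertex) (m : ℝ → ℤ) (b : ℝ → Sym2 HexVertex), AdmissibleFamily D ρ Λ m b → ExactPolygonFamily D Λ → ∀ (a : ℝ → Sym2 HexVertex) (r₀ : ℝ) (m₀ : ℝ → ℤ), PinnedFlatRoot D Λ b (D.pt 0) a r₀ m₀ → RatioMixingAt Λ a b)) → DefectDecoherence → MassRatio → ∀ (D : DobrushinDomain) (ρ : ℝ) (Λ : ℝ → Finset HexVertex) (m : ℝ → ℤ) (b : ℝ → Sym2 HexVertex), AdmissibleFamily D ρ Λ m b → ExactPolygonFamily D Λ → ∀ (a : ℝ → Sym2 HexVertex) (r₀ : ℝ) (m₀ : ℝ → ℤ), PinnedFlatRoot D Λ b (D.pt 0) a r₀ m₀ → 2 * ρ < dist (D.pt 0) (D.pt 1) → GateProfileAt D ρ (ρ / 2) Λ a b :=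
  Summit.CriticalPhenomena.SAWScalingLimit.Theorems.PolygonParitySqueeze.stub_polygonIdentification

/-- STUB 4 (MODEL INPUT, positive masses, qualitative; OPEN): `GateCollarAvoidance`. -/
theorem stub_gateCollarAvoidance : ∀ (D : DobrushinDomain) (ρ : ℝ) (Λ : ℝ → Finset HexVertex) (m : ℝ → ℤ) (b : ℝ → Sym2 HexVertex), AdmissibleFamily D ρ Λ m b → ∀ (a : ℝ → Sym2 HexVertex) (r₀ : ℝ) (m₀ : ℝ → ℤ), PinnedFlatRoot D Λ b (D.pt 0) a r₀ m₀ → CollarAvoidanceAt D ρ Λ a r₀ := by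
  sorry

/-- STUB 5a (CLOSED — lattice half of mechanism (B)): `ArrivalMonotone`, LANDED by lead c6 (p137937,
`Theorems/SAWDefectDecoherenceBoundaryClosureRArrivalMonotone.lean`). [folklore] -/
theorem stub_arrivalMonotone : ∀ (Λ Λ' : Finset HexVertex), Λ ⊆ Λ' → ∀ (a z : Sym2 HexVertex) (x : ℝ), 0 ≤ x → ‖hexParafermionicObservable Λ a x 0 z‖ ≤ ‖hexParafermionicObservable Λ' a x 0 z‖ :=
  Summit.CriticalPhenomena.SAWScalingLimit.Theorems.PolygonParitySqueeze.stub_arrivalMonotone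

/-- STUB 7a (CLOSED — LANDED p153105 `Theorems/…InnerZigzagPolygon.lean` + 10 helper files): **inner zigzag
polygon** `InnerZigzagPolygon` (mesh-`h` triangular grid with both pin lines as grid lines; super-hexagon tiles deep
inside `Ω` ∪ two grid trapezoids on the pins; no pinch ⇒ vertex-simple boundary walk ⇒ `polygonDomain`; inside/outside
by the tree's JCT). [folklore] -/
theorem stub_innerZigzagPolygon : ∀ (D : DobrushinDomain) (ρ r₁ η : ℝ), 0 < ρ → 0 < r₁ → 0 < η → D.carrier ∩ Metric.ball (D.pt 1) ρ = {z : ℂ | (D.pt 1).im < z.im} ∩ Metric.ball (D.pt 1) ρ → D.carrier ∩ Metric.ball (D.pt 0) r₁ = {z : ℂ | (D.pt 0).im < z.im} ∩ Metric.ball (D.pt 0) r₁ → ρ + r₁ ≤ dist (D.pt 0) (D.pt 1) → ∃ (P : DobrushinDomain) (corners : Finset ℂ) (r : ℝ), P.pt 0 = D.pt 0 ∧ P.pt 1 = D.pt 1 ∧ P.carrier ⊆ D.carrier ∧ {z : ℂ | z ∈ D.carrier ∧ η ≤ Metric.infDist z D.carrierᶜ} ⊆ P.carrier ∧ P.carrier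 ∩ Metric.ball (D.pt 1) (7 * ρ / 8) = {z : ℂ | (D.pt 1).im < z.im} ∩ Metric.ball (D.pt 1) (7 * ρ / 8) ∧ P.carrier ∩ Metric.ball (D.pt 0) (7 * r₁ / 8) = {z : ℂ | (D.pt 0).im < z.im} ∩ Metric.ball (D.pt 0) (7 * r₁ / 8) ∧ frontier P.carrier \ (Metric.ball (D.pt 1) (15 * ρ / 16) ∪ Metric.ball (D.pt 0) (15 * r₁ / 16)) ⊆ D.carrier ∧ 0 < r ∧ r ≤ ρ / 16 ∧ r ≤ r₁ / 16 ∧ (↑corners : Set ℂ) ⊆ frontier P.carrier ∧ (∀ i : Fin 2, ∀ c ∈ corners, r ≤ dist (P.pt i) c) ∧ (∀ z ∈ frontier P.carrier, (∀ c ∈ corners, r ≤ dist z c) → ∃ k : Fin 6, P.carrier ∩ Metric.ball z (r / 2) = halfPlane k z ∩ Metric.ball z (r / 2)) ∧ (∀ z ∈ corners, ∃ k k' : Fin 6, P.carrier ∩ Metric.ball z (2 * r) = halfPlane k z ∩ halfPlane k' z ∩ Metric.ball z (2 * r) ∨ P.carrier ∩ Metric.ball z (2 * r) = (halfPlane k z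 ∪ halfPlane k' z) ∩ Metric.ball z (2 * r)) :=
  Summit.CriticalPhenomena.SAWScalingLimit.Theorems.PolygonParitySqueeze.stub_innerZigzagPolygon

/-- STUB 7a′ (CLOSED — LANDED p154287 `Theorems/…InnerZigzagSep.lean`): 7a with pairwise corner separation. [folklore] -/
theorem stub_innerZigzagPolygonSep : ∀ (D : DobrushinDomain) (ρ r₁ η : ℝ), 0 < ρ → 0 < r₁ → 0 < η → D.carrier ∩ Metric.ball (D.pt 1) ρ = {z : ℂ | (D.pt 1).im < z.im} ∩ Metric.ball (D.pt 1) ρ → D.carrier ∩ Metric.ball (D.pt 0) r₁ = {z : ℂ | (D.pt 0).im < z.im} ∩ Metric.ball (D.pt 0) r₁ → ρ + r₁ ≤ dist (D.pt 0) (D.pt 1) → ∃ (P : DobrushinDomain) (corners : Finset ℂ) (r : ℝ), P.pt 0 = D.pt 0 ∧ P.pt 1 = D.pt 1 ∧ P.carrier ⊆ D.carrier ∧ {z : ℂ | z ∈ D.carrier ∧ η ≤ Metric.infDist z D.carrierᶜ} ⊆ P.carrier ∧ P.carrier ∩ Metric.ball (D.pt 1) (7 * ρ / 8) = {z : ℂ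 | (D.pt 1).im < z.im} ∩ Metric.ball (D.pt 1) (7 * ρ / 8) ∧ P.carrier ∩ Metric.ball (D.pt 0) (7 * r₁ / 8) = {z : ℂ | (D.pt 0).im < z.im} ∩ Metric.ball (D.pt 0) (7 * r₁ / 8) ∧ frontier P.carrier \ (Metric.ball (D.pt 1) (15 * ρ / 16) ∪ Metric.ball (D.pt 0) (15 * r₁ / 16)) ⊆ D.carrier ∧ 0 < r ∧ r ≤ ρ / 16 ∧ r ≤ r₁ / 16 ∧ (↑corners : Set ℂ) ⊆ frontier P.carrier ∧ (∀ i : Fin 2, ∀ c ∈ corners, r ≤ dist (P.pt i) c) ∧ (∀ c ∈ corners, ∀ c' ∈ corners, c ≠ c' → 4 * r ≤ dist c c') ∧ (∀ z ∈ frontier P.carrier, (∀ c ∈ corners, r ≤ dist z c) → ∃ k : Fin 6, P.carrier ∩ Metric.ball z (r / 2) = halfPlane k z ∩ Metric.ball z (r / 2)) ∧ (∀ z ∈ corners, ∃ k k' : Fin 6, P.carrier ∩ Metric.ball z (2 * r) = halfPlane k z ∩ halfPlane k' z ∩ Metric.ball z (2 * r) ∨ P.carrier ∩ Metric.ball z (2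 * r) = (halfPlane k z ∪ halfPlane k' z) ∩ Metric.ball z (2 * r)) :=
  Summit.CriticalPhenomena.SAWScalingLimit.Theorems.PolygonParitySqueeze.stub_innerZigzagPolygonSep

/-- STUB 7b (CLOSED — LANDED p161626 `Theorems/…ZigzagDiscretisation.lean` + 16 helper files): **exact discretisation of
an inner zigzag polygon**, `InnerZigzagPolygonSep → InnerPolygons` (universal local tests with pin-zone thresholds;
exactness radius `r/2`; uniform thick chains; lattice tubes; six monotone normal walks). [folklore] -/
theorem stub_innerPolygonsOfZigzag : (∀ (D : DobrushinDomain) (ρ r₁ η : ℝ), 0 < ρ → 0 < r₁ → 0 < η → D.carrier ∩ Metric.ball (D.pt 1) ρ = {z : ℂ | (D.pt 1).im < z.im} ∩ Metric.ball (D.pt 1) ρ → D.carrier ∩ Metric.ball (D.pt 0) r₁ = {z : ℂ | (D.pt 0).im < z.im} ∩ Metric.ball (D.pt 0) r₁ → ρ + r₁ ≤ dist (D.pt 0) (D.pt 1) → ∃ (P : DobrushinDomain) (corners : Finset ℂ) (r : ℝ), P.pt 0 = D.pt 0 ∧ P.pt 1 = D.pt 1 ∧ P.carrier ⊆ D.carrier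 ∧ {z : ℂ | z ∈ D.carrier ∧ η ≤ Metric.infDist z D.carrierᶜ} ⊆ P.carrier ∧ P.carrier ∩ Metric.ball (D.pt 1) (7 * ρ / 8) = {z : ℂ | (D.pt 1).im < z.im} ∩ Metric.ball (D.pt 1) (7 * ρ / 8) ∧ P.carrier ∩ Metric.ball (D.pt 0) (7 * r₁ / 8) = {z : ℂ | (D.pt 0).im < z.im} ∩ Metric.ball (D.pt 0) (7 * r₁ / 8) ∧ frontier P.carrier \ (Metric.ball (D.pt 1) (15 * ρ / 16) ∪ Metric.ball (D.pt 0) (15 * r₁ / 16)) ⊆ D.carrier ∧ 0 < r ∧ r ≤ ρ / 16 ∧ r ≤ r₁ / 16 ∧ (↑corners : Set ℂ) ⊆ frontier P.carrier ∧ (∀ i : Fin 2, ∀ c ∈ corners, r ≤ dist (P.pt i) c) ∧ (∀ c ∈ corners, ∀ c' ∈ corners, c ≠ c' → 4 * r ≤ dist c c') ∧ (∀ z ∈ frontier P.carrier, (∀ c ∈ corners, r ≤ dist z c) → ∃ k : Fin 6, P.carrier ∩ Metric.ball z (r / 2) = halfPlane k z ∩ Metric.ball z (r / 2)) ∧ (∀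 z ∈ corners, ∃ k k' : Fin 6, P.carrier ∩ Metric.ball z (2 * r) = halfPlane k z ∩ halfPlane k' z ∩ Metric.ball z (2 * r) ∨ P.carrier ∩ Metric.ball z (2 * r) = (halfPlane k z ∪ halfPlane k' z) ∩ Metric.ball z (2 * r))) → (∀ (D : DobrushinDomain) (ρ : ℝ) (Λ : ℝ → Finset HexVertex) (m : ℝ → ℤ) (b : ℝ → Sym2 HexVertex), AdmissibleFamily D ρ Λ m b → ∀ (a : ℝ → Sym2 HexVertex) (r₀ : ℝ) (m₀ : ℝ → ℤ), PinnedFlatRoot D Λ b (D.pt 0) a r₀ m₀ → 2 * ρ < dist (D.pt 0) (D.pt 1) → ∀ η : ℝ, 0 < η → ∃ (P : DobrushinDomain) (ΛP : ℝ → Finset HexVertex), P.pt 0 = D.pt 0 ∧ P.pt 1 = D.pt 1 ∧ P.carrier ⊆ D.carrier ∧ {z : ℂ | z ∈ D.carrier ∧ η ≤ Metric.infDist z D.carrierᶜ} ⊆ P.carrier ∧ AdmissibleFamily P (ρ / 2) ΛP m b ∧ ExactPolygonFamily P ΛP ∧ PinnedFlatRoot P ΛP b (P.pt 0) a (min r₀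 ρ / 4) m₀ ∧ ∀ᶠ δ : ℝ in 𝓝[>] 0, collarDomain D (3 * ρ / 4) (min r₀ ρ / 2) η δ (Λ δ) ⊆ ΛP δ ∧ ΛP δ ⊆ Λ δ) :=
  Summit.CriticalPhenomena.SAWScalingLimit.Theorems.PolygonParitySqueeze.stub_innerPolygonsOfZigzag

/-- STUB 7 (CLOSED): **(IP) inner exact polygons** `InnerPolygons` `:= 7b ∘ 7a′`. [folklore] -/
theorem stub_innerPolygons : (∀ (D : DobrushinDomain) (ρ : ℝ) (Λ : ℝ → Finset HexVertex) (m : ℝ → ℤ) (b : ℝ → Sym2 HexVertex), AdmissibleFamily D ρ Λ m b → ∀ (a : ℝ → Sym2 HexVertex) (r₀ : ℝ) (m₀ : ℝ → ℤ), PinnedFlatRoot D Λ b (D.pt 0) a r₀ m₀ → 2 * ρ < dist (D.pt 0) (D.pt 1) → ∀ η : ℝ, 0 < η → ∃ (P : DobrushinDomain) (ΛP : ℝ → Finset HexVertex), P.pt 0 = D.pt 0 ∧ P.pt 1 = D.pt 1 ∧ P.carrier ⊆ D.carrier ∧ {z : ℂ | z ∈ D.carrier ∧ η ≤ Metric.infDist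 z D.carrierᶜ} ⊆ P.carrier ∧ AdmissibleFamily P (ρ / 2) ΛP m b ∧ ExactPolygonFamily P ΛP ∧ PinnedFlatRoot P ΛP b (P.pt 0) a (min r₀ ρ / 4) m₀ ∧ ∀ᶠ δ : ℝ in 𝓝[>] 0, collarDomain D (3 * ρ / 4) (min r₀ ρ / 2) η δ (Λ δ) ⊆ ΛP δ ∧ ΛP δ ⊆ Λ δ) :=
  stub_innerPolygonsOfZigzag stub_innerZigzagPolygonSep

/-- STUB 8 (CLOSED — LANDED p145306, `Theorems/…BoundaryClosureRGateStability.lean`): **(GS) gate stability**.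
[cite: PommerenkeBBCM1992, Thm. 1.8] -/
theorem stub_gateStability : (∀ (D : DobrushinDomain) (ρ r₀ r' : ℝ), 0 < ρ → 0 < r' → r' ≤ r₀ → D.carrier ∩ Metric.ball (D.pt 1) ρ = {z : ℂ | (D.pt 1).im < z.im} ∩ Metric.ball (D.pt 1) ρ → D.carrier ∩ Metric.ball (D.pt 0) r₀ = {z : ℂ | (D.pt 0).im < z.im} ∩ Metric.ball (D.pt 0) r₀ → 2 * ρ < dist (D.pt 0) (D.pt 1) → ∀ (Φ : ConformalEquiv D.carrier UpperHalfPlane.upperHalfPlaneSet) (L : ℂ → ℂ) (Lb : ℂ), ConformalFrame D Φ L Lb → ∀ (Lbar : ℂ → ℂ), ContinuousOn Lbar (D.carrier ∪ gateSeg D ρ) → EqOn Lbar L D.carrier → ∀ (P : ℕ → DobrushinDomain), (∀ n, (P n).pt 0 = D.pt 0 ∧ (P n).pt 1 = D.pt 1 ∧ (P n).carrier ⊆ D.carrier ∧ (P n).carrier ∩ Metric.ball (D.pt 1) (ρ / 2) = {z : ℂ | (D.pt 1).im < z.im} ∩ Metric.ball (D.pt 1) (ρ / 2) ∧ (P n).carrier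 ∩ Metric.ball (D.pt 0) r' = {z : ℂ | (D.pt 0).im < z.im} ∩ Metric.ball (D.pt 0) r') → (∀ K : Set ℂ, IsCompact K → K ⊆ D.carrier → ∀ᶠ n : ℕ in atTop, K ⊆ (P n).carrier) → ∃ (ΦP : (n : ℕ) → ConformalEquiv (P n).carrier UpperHalfPlane.upperHalfPlaneSet) (LP : ℕ → ℂ → ℂ) (LbP : ℕ → ℂ) (LbarP : ℕ → ℂ → ℂ), (∀ n, ConformalFrame (P n) (ΦP n) (LP n) (LbP n) ∧ ContinuousOn (LbarP n) ((P n).carrier ∪ gateSeg (P n) (ρ / 2)) ∧ EqOn (LbarP n) (LP n) (P n).carrier) ∧ TendstoUniformlyOn (fun n x => Complex.exp ((5 / 8 : ℂ) * (LbarP n x - LbP n))) (fun x => Complex.exp ((5 / 8 : ℂ) * (Lbar x - Lb))) atTop (gateSeg D (ρ / 4))) :=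
  Summit.CriticalPhenomena.SAWScalingLimit.Theorems.PolygonParitySqueeze.stub_gateStability

/-- STUB 5 (CLOSED modulo 7a, 7b — mechanism (B), LANDED reduction p141029
`Theorems/…BoundaryClosureRSqueeze.lean`): **the squeeze**,
`ArrivalMonotone → PolygonGateProfile → PolygonPackage → GateCollarAvoidance → GateData`, from (IP) and (GS):
collar avoidance and monotonicity pinch the normalised gate functional of `Λ` against that of an inner polygon
family (`profile_pinch_at`), `PolygonGateProfile` gives the polygon's limit in the polygon's frame, (GS) moves the
frame, three epsilons. [cite: DuminilCopinSmirnov2012, Conjecture 2 (boundary shadow on the gate)] -/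
theorem stub_squeeze : (∀ (Λ Λ' : Finset HexVertex), Λ ⊆ Λ' → ∀ (a z : Sym2 HexVertex) (x : ℝ), 0 ≤ x → ‖hexParafermionicObservable Λ a x 0 z‖ ≤ ‖hexParafermionicObservable Λ' a x 0 z‖) → (∀ (D : DobrushinDomain) (ρ : ℝ) (Λ : ℝ → Finset HexVertex) (m : ℝ → ℤ) (b : ℝ → Sym2 HexVertex), AdmissibleFamily D ρ Λ m b → ExactPolygonFamily D Λ → ∀ (a : ℝ → Sym2 HexVertex) (r₀ : ℝ) (m₀ : ℝ → ℤ), PinnedFlatRoot D Λ b (D.pt 0) a r₀ m₀ → 2 * ρ < dist (D.pt 0) (D.pt 1) → GateProfileAt D ρ (ρ / 2) Λ a b) → ((∀ (D : DobrushinDomain) (ρ : ℝ) (Λ : ℝ → Finset HexVertex) (m : ℝ → ℤ) (b : ℝ → Sym2 HexVertex), AdmissibleFamily D ρ Λ m b → ExactPolygonFamily D Λ → ∀ (a : ℝ → Sym2 HexVertex) (r₀ : ℝ) (m₀ : ℝ → ℤ), PinnedFlatRoot D Λ b (D.pt 0) a r₀ m₀ → (∀ K : Set ℂ, IsCompact K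 → K ⊆ closure D.carrier → D.pt 0 ∉ K → L1BoundOn Λ a b K) ∧ RootTightAt Λ a b (D.pt 0)) ∧ (∀ (D : DobrushinDomain) (ρ : ℝ) (Λ : ℝ → Finset HexVertex) (m : ℝ → ℤ) (b : ℝ → Sym2 HexVertex), AdmissibleFamily D ρ Λ m b → ExactPolygonFamily D Λ → ∀ (a : ℝ → Sym2 HexVertex) (r₀ : ℝ) (m₀ : ℝ → ℤ), PinnedFlatRoot D Λ b (D.pt 0) a r₀ m₀ → (∀ z ∈ frontier D.carrier, z ≠ D.pt 0 → BoundaryLayerBudgetAt Λ a b z) ∧ (2 * ρ < dist (D.pt 0) (D.pt 1) → GateLayerBudgetAt D (ρ / 2) Λ m a b)) ∧ (∀ (D : DobrushinDomain) (ρ : ℝ) (Λ : ℝ → Finset HexVertex) (m : ℝ → ℤ) (b : ℝ → Sym2 HexVertex), AdmissibleFamily D ρ Λ m b → ExactPolygonFamily D Λ → ∀ (a : ℝ → Sym2 HexVertex) (r₀ : ℝ) (m₀ : ℝ → ℤ), PinnedFlatRoot D Λ b (D.pt 0) a r₀ m₀ → RatioMixingAt Λ a b)) → (∀ (D : DobrushinDomain)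 (ρ : ℝ) (Λ : ℝ → Finset HexVertex) (m : ℝ → ℤ) (b : ℝ → Sym2 HexVertex), AdmissibleFamily D ρ Λ m b → ∀ (a : ℝ → Sym2 HexVertex) (r₀ : ℝ) (m₀ : ℝ → ℤ), PinnedFlatRoot D Λ b (D.pt 0) a r₀ m₀ → CollarAvoidanceAt D ρ Λ a r₀) → ∀ (D : DobrushinDomain) (ρ : ℝ) (Λ : ℝ → Finset HexVertex) (m : ℝ → ℤ) (b : ℝ → Sym2 HexVertex), AdmissibleFamily D ρ Λ m b → ∀ (a : ℝ → Sym2 HexVertex) (r₀ : ℝ) (m₀ : ℝ → ℤ), PinnedFlatRoot D Λ b (D.pt 0) a r₀ m₀ → 2 * ρ < dist (D.pt 0) (D.pt 1) → GateProfileAt D ρ (ρ / 4) Λ a b ∧ GateLayerBudgetAt D (ρ / 4) Λ m a b :=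
  Summit.CriticalPhenomena.SAWScalingLimit.Theorems.PolygonParitySqueeze.squeeze_of_innerPolygons
    stub_innerPolygons stub_gateStability

/-- STUB 9 (CLOSED — LANDED p145867, `Theorems/…BoundaryClosureRGateDbarLimit.lean`): **(GDL) the gate
`∂̄`-limit**. [cite: DuminilCopinSmirnov2012, Lemma 1] -/
theorem stub_gateDbarLimit : (∀ (D : DobrushinDomain) (ρ : ℝ) (Λ : ℝ → Finset HexVertex) (m : ℝ → ℤ) (b : ℝ → Sym2 HexVertex), AdmissibleFamily D ρ Λ m b → ∀ (a : ℝ → Sym2 HexVertex) (r₀ : ℝ) (m₀ : ℝ → ℤ), PinnedFlatRoot D Λ b (D.pt 0) a r₀ m₀ → 2 * ρ < dist (D.pt 0) (D.pt 1) → DefectDecoherence → GateProfileAt D ρ (ρ / 4) Λ a b → GateLayerBudgetAt D (ρ / 4) Λ m a b → ∀ (Φ : ConformalEquiv D.carrier UpperHalfPlane.upperHalfPlaneSet) (L : ℂ → ℂ) (Lb : ℂ), ConformalFrame D Φ L Lb → ∀ (Lbar : ℂ → ℂ), ContinuousOn Lbar (D.carrier ∪ gateSeg D ρ) → Set.EqOn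 Lbar L D.carrier → ∀ (φ : ℂ → ℂ), ContDiff ℝ ∞ φ → HasCompactSupport φ → tsupport φ ⊆ Metric.ball (D.pt 1) (ρ / 4) → Filter.Tendsto (fun δ : ℝ => NF Λ a b δ (Literature.Analysis.Complex.dbarAlong 1 φ)) (𝓝[>] 0) (𝓝 (-(Complex.I * (Real.sqrt 3 : ℂ)) * ∫ x in Set.Ioo ((D.pt 1).re - ρ / 4) ((D.pt 1).re + ρ / 4), φ ((x : ℂ) + ((D.pt 1).im : ℂ) * Complex.I) * Complex.exp ((5 / 8 : ℂ) * (Lbar ((x : ℂ) + ((D.pt 1).im : ℂ) * Complex.I) - Lb))))) :=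
  Summit.CriticalPhenomena.SAWScalingLimit.Theorems.PolygonParitySqueeze.GateDbar.stub_gateDbarLimit

/-- STUB 6 (CLOSED — mechanism (C), LANDED reduction p141188 `Theorems/…BoundaryClosureRGateTraceOfGateData.lean`):
**gate trace from gate data**, `GateData → GateL1Root → DefectDecoherence → MassRatio → GateTraceH`: weak-* limit of
`N_δ` on a full small gate ball (`gateTrace_l1Bound_gateBall`), `= g dA` above the gate and `0` below, pairing
`∂̄φ` by (GDL), Green for the candidate `2√3·exp((5/8)(L̄ − L_b))`, flat-arc uniqueness, identity theorem;
universal constant `c = 2√3`. [cite: DuminilCopinSmirnov2012, Conjecture 2 (identification on the gate)] -/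
theorem stub_gateTrace : (∀ (D : DobrushinDomain) (ρ : ℝ) (Λ : ℝ → Finset HexVertex) (m : ℝ → ℤ) (b : ℝ → Sym2 HexVertex), AdmissibleFamily D ρ Λ m b → ∀ (a : ℝ → Sym2 HexVertex) (r₀ : ℝ) (m₀ : ℝ → ℤ), PinnedFlatRoot D Λ b (D.pt 0) a r₀ m₀ → 2 * ρ < dist (D.pt 0) (D.pt 1) → GateProfileAt D ρ (ρ / 4) Λ a b ∧ GateLayerBudgetAt D (ρ / 4) Λ m a b) → (∀ (D : DobrushinDomain) (ρ : ℝ) (Λ : ℝ → Finset HexVertex) (m : ℝ → ℤ) (b : ℝ → Sym2 HexVertex), AdmissibleFamily D ρ Λ m b → ∀ (a : ℝ → Sym2 HexVertex) (r₀ : ℝ) (m₀ : ℝ → ℤ), PinnedFlatRoot D Λ b (D.pt 0) a r₀ m₀ → ∀ K : Set ℂ, IsCompact K → K ⊆ D.carrier ∪ gateSeg D ρ → D.pt 0 ∉ K → L1BoundOn Λ a b K) → DefectDecoherence → MassRatio → ∃ c : ℂ, c ≠ 0 ∧ ∀ (D : DobrushinDomain) (ρ : ℝ) (Λ : ℝ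 → Finset HexVertex) (m : ℝ → ℤ) (b : ℝ → Sym2 HexVertex), AdmissibleFamily D ρ Λ m b → ∀ (a : ℝ → Sym2 HexVertex) (r₀ : ℝ) (m₀ : ℝ → ℤ), PinnedFlatRoot D Λ b (D.pt 0) a r₀ m₀ → HasGateTrace c D ρ Λ a b :=
  Summit.CriticalPhenomena.SAWScalingLimit.Theorems.PolygonParitySqueeze.gateTrace_of_gateDbarLimit
    stub_gateDbarLimit

/-! ### The stub headers ARE the named statements (definitional unfolding) -/

/-- `stub_gateL1Root` states `GateL1Root`. [folklore] -/
theorem gateL1Root_holds_of_stub : GateL1Root := stub_gateL1Root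

/-- `stub_polygonPackage` states `PolygonPackage`. [folklore] -/
theorem polygonPackage_holds_of_stub : PolygonPackage := stub_polygonPackage

/-- `stub_polygonIdentification` states `PolygonPackage → DD → MR → PolygonGateProfile`. [folklore] -/
theorem polygonIdentification_of_stub :
    PolygonPackage → DefectDecoherence → MassRatio → PolygonGateProfile := stub_polygonIdentification

/-- `stub_gateCollarAvoidance` states `GateCollarAvoidance`. [folklore] -/
theorem gateCollarAvoidance_holds_of_stub : GateCollarAvoidance := stub_gateCollarAvoidance

/-- `stub_arrivalMonotone` states `ArrivalMonotone`. [folklore] -/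
theorem arrivalMonotone_holds_of_stub : ArrivalMonotone := stub_arrivalMonotone

/-- `stub_innerZigzagPolygon` states `InnerZigzagPolygon`. [folklore] -/
theorem innerZigzagPolygon_holds_of_stub : InnerZigzagPolygon := stub_innerZigzagPolygon

/-- `stub_innerPolygonsOfZigzag` states `InnerZigzagPolygonSep → InnerPolygons`. [folklore] -/
theorem innerPolygons_of_innerZigzagPolygonSep : InnerZigzagPolygonSep → InnerPolygons := stub_innerPolygonsOfZigzag

/-- `stub_innerZigzagPolygonSep` states `InnerZigzagPolygonSep` (closed). [folklore] -/
theorem innerZigzagPolygonSep_holds : InnerZigzagPolygonSep := stub_innerZigzagPolygonSep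

/-- `stub_innerPolygons` states `InnerPolygons`. [folklore] -/
theorem innerPolygons_holds_of_stub : InnerPolygons := stub_innerPolygons

/-- `stub_gateStability` states `GateStability` (closed). [folklore] -/
theorem gateStability_holds : GateStability := stub_gateStability

/-- `stub_gateDbarLimit` states `GateDbarLimit` (closed). [folklore] -/
theorem gateDbarLimit_holds : GateDbarLimit := stub_gateDbarLimit

/-- `stub_squeeze` states `ArrivalMonotone → PolygonGateProfile → PolygonPackage → GateCollarAvoidance →
GateData`. [folklore] -/
theorem squeeze_of_stub :
    ArrivalMonotone → PolygonGateProfile → PolygonPackage → GateCollarAvoidance → GateData := stub_squeeze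

/-- `stub_gateTrace` states `GateData → GateL1Root → DD → MR → GateTraceH`. [folklore] -/
theorem gateTrace_of_stub :
    GateData → GateL1Root → DefectDecoherence → MassRatio → GateTraceH := stub_gateTrace

/-! ## E. The composition (kernel-checked; `sorry` enters only through the seven stubs) -/

/-- **The crux from the seven statements** (hypothesis form): identification on exact polygons (A),
domain monotonicity + squeeze (B) and gate trace (C) produce `[II] GateTraceH` from the polygon
package, collar avoidance and `GateL1Root`; `GateL1Root ⊇ [I]`; the landed certificate
`Equivalence.target_of_inputs` closes `HexObservableLimitR`, i.e. `BoundaryClosureR` BY NAME. -/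
theorem BoundaryClosureR_of
    (h1 : GateL1Root) (h2 : PolygonPackage)
    (h3 : PolygonPackage → DefectDecoherence → MassRatio → PolygonGateProfile)
    (h4 : GateCollarAvoidance) (h5a : ArrivalMonotone)
    (h5 : ArrivalMonotone → PolygonGateProfile → PolygonPackage → GateCollarAvoidance → GateData)
    (h6 : GateData → GateL1Root → DefectDecoherence → MassRatio → GateTraceH) :
    Summit.CriticalPhenomena.SAWScalingLimit.Theses.SAWDefectDecoherence.BoundaryClosureR :=
  fun hDD hMR =>
    Summit.CriticalPhenomena.SAWScalingLimit.Theorems.PickHalfPlane.Equivalence.target_of_inputs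
      hDD hMR (localL1Root_of_gateL1Root h1) (h6 (h5 h5a (h3 h2 hDD hMR) h2 h4) h1 hDD hMR)

/-- **The crux, closed modulo the registered stubs** (r6: the only `sorry`s are the three MODEL INPUTS `stub_gateL1Root`,
`stub_polygonPackage`, `stub_gateCollarAvoidance`; Theorems-side copy: `BoundaryClosureR_of_conditionalInputs`). -/
theorem BoundaryClosureR_closed :
    Summit.CriticalPhenomena.SAWScalingLimit.Theses.SAWDefectDecoherence.BoundaryClosureR :=
  BoundaryClosureR_of stub_gateL1Root stub_polygonPackage stub_polygonIdentification
    stub_gateCollarAvoidance stub_arrivalMonotone stub_squeeze stub_gateTrace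

end Summit.CriticalPhenomena.SAWScalingLimit.Cruxes.BoundaryClosureR.PolygonParitySqueeze

end
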